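import Literature.NumberTheory.LFunctions.BaezDuarteTestVectors
import Literature.NumberTheory.LFunctions.RHWave0HardyProofs
import HarnessLib

/-!
# The Báez-Duarte–Balazard–Landreau–Saias lower bound `‖χ - Σ c_k ρ_{a_k}‖₂ ≥ C/√log N` — proof

Topic `Literature/NumberTheory/LFunctions` (Nyman–Beurling circle), fourth and last analytic file of
the proof of `Literature.Barriers.RiemannHypothesis.BDBLS2000_uniform` (BDBLS 2000, as printed in Báez-Duarte 2003,
§1 (1.3)); the barrier catalogue's companion file only converts the real-valued statement proved
here (`Literature.NumberTheory.LFunctions.BaezDuarteU.lowerBound_real`) into the `ℝ≥0∞`-valued form of the named fact.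

## The argument (BDBLS's strategy, as described by Burnol 2004, §5, arranged through `L²` identities only)

Let `f = χ - F`, `F = Σ c_k ρ_{a_k}` (`1 ≤ a_k ≤ N`), `d = ‖f‖₂`, `κ = Σ c_k/a_k`, and let
`ρ = 1/2 + iγ` be a zero of `ζ` on the critical line (Hardy 1914;
`Literature.NumberTheory.LFunctions.hardy_infinite_zeros_on_critical_line_holds`). Let `U` be Báez-Duarte's unitary operator (Mellin
multiplier `U(s) = sχ̃(s)/(1-s)`, `ζ(1-s) = χ̃(s)ζ(s)`): `Uχ = sin(2πt)/(πt)`, `Uρ_a = {at}/(at)`, so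
`f♯ := Uf = sin(2πt)/(πt) - Σ c_k {a_k t}/(a_k t)` and `‖f♯‖₂ = d`
(`Literature.NumberTheory.LFunctions.BaezDuarteU.integral_norm_sq_nbDual_eq`). With the test vectors `e_w = t^{w̄-1}𝟙_{(0,1]}`,
`w = ρ + η`, `η ↓ 0`:

1. `⟨f, e_w⟩ = ∫_0^1 f t^{w-1} = (1 + ζ(w)P(w))/w - κ/(w-1)` (`P(s) = Σ c_k a_k^{-s}`; tree lemma
   `Literature.NumberTheory.LFunctions.mellin_beurlingRhoTrunc_eq`), which at `w = ρ` is `1/ρ - κ/(ρ-1)`, of modulus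
   `≥ (1-|κ|)/|ρ| ≥ (1-d)/|ρ|` (`|κ| ≤ d` from `f = -κ/t` on `(1,∞)`).
2. **Key estimate** (`Literature.NumberTheory.LFunctions.BaezDuarteU.norm_pairing_sub_le`): `|⟨f,e_w⟩ - ⟨f♯,e_w⟩/U(w)| ≤ d√M`
   uniformly in `η`, by polarized Mellin–Parseval, `M[f♯] = U·M[f]` and the Lipschitz property of
   `U` near `ρ`; letting `η → 0`: `|1/ρ - κ/(ρ-1) - ⟨f♯,e_ρ⟩/U(ρ)| ≤ d√M`, `|U(ρ)| = 1`.
3. `⟨f♯, e_ρ⟩ = ∫_0^1 f♯ t^{ρ-1}`: on `(θ,1]` Cauchy–Schwarz gives `≤ d√log(1/θ)`; on `(0,θ]`,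
   `θ = θ₀/N`, all `{a_k t}/(a_k t) ≡ 1`, so `f♯ = sin(2πt)/(πt) - P(0)` there and the integral is
   `≤ 2√θ(2 + |P(0)|)`, while `|P(0)|/√N ≲ d + 1/√N` from `‖f♯‖_{L²(0,1/2N)} ≤ d`.
4. Hence `(1-d)/|ρ| ≤ d√M + d√(log N + log(1/θ₀)) + 10√θ₀ + 4d√θ₀`; choosing `θ₀` with
   `10√θ₀ ≤ 1/(2|ρ|)` gives `d ≥ C/√log N` for `N ≥ 2`, `C = C(ρ) > 0`.

## References

* [BDBLS2000] L. Báez-Duarte, M. Balazard, B. Landreau, E. Saias, *Notes sur la fonction ζ de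
  Riemann, 3*, Adv. Math. 149 (2000), 130–144 (the theorem; their proof uses the same test vectors
  and Báez-Duarte's `U`, with pointwise estimates (Lemme 6) where we use `L²` ones).
* [BaezDuarte2003] L. Báez-Duarte, Rend. Lincei (9) 14 (2003), 5–11 (arXiv:math/0202141), §1 (1.3):
  "for any `F = Σ_{k=1}^n c_k ρ_{a_k}`, `a_k ≥ 1`, if `N = max a_k`, then `‖F-χ‖_𝓗 ≥ C/√log N` for
  an absolute constant `C`".
* [Burnol2002] J.-F. Burnol, Adv. Math. 170 (2002), 56–70, Thm. 1.2 (= BDBLS) and §§3–5.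
* [Burnol2004] J.-F. Burnol, *On Fourier and Zeta(s)*, Forum Math. 16 (2004), 789–840, §5: "The first
  candidates are `t ↦ t^{-ρ}`: they satisfy formally the perpendicularity condition to `{1/t}` and its
  contractions, but they do not belong to `L²`. … the square integrable vectors
  `t ↦ t^{-(ρ-ε)}𝟙_{0<t<1}` … The authors of [BDBLS] followed more or less this strategy … For their
  technical estimates [they] used to great advantage a certain scale invariant operator `U`".
* [Hardy1914] G. H. Hardy, C. R. Acad. Sci. Paris 158 (1914), 1012–1014 (a zero on the line).
-/

noncomputable section

open Complex MeasureTheory Set Filter Metric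
open scoped Real Topology ComplexConjugate

namespace Literature.NumberTheory.LFunctions

namespace BaezDuarteU


variable {n : ℕ} (a c : Fin n → ℝ)

/-! ## Step 0: a zero on the critical line -/

/-- There is a zero of `ζ` on the critical line (Hardy 1914, proved in the tree).
[cite: Hardy1914, C. R. Acad. Sci. Paris 158 (1914) 1012–1014] -/
theorem exists_zeta_zero_half : ∃ γ : ℝ, riemannZeta (1 / 2 + γ * I) = 0 :=
  Literature.NumberTheory.LFunctions.hardy_infinite_zeros_on_critical_line_holds.nonempty

/-! ## Step 1: the pairing `⟨f, e_ρ⟩ = 1/ρ - κ/(ρ-1)` and `|κ| ≤ d` -/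

/-- On `(0,1]`, `f𝟙_{(0,1]} = 𝟙_{(0,1]} - Σ c_k · ({1/(a_k t)}𝟙_{(0,1]})` (the tree's `beurlingRhoTrunc`).
[folklore] -/
lemma indicator_nbFun_eq (t : ℝ) : (Ioc (0 : ℝ) 1).indicator (nbFun a c) t =
    (Ioc (0 : ℝ) 1).indicator (fun _ ↦ (1 : ℂ)) t - ∑ j, (c j : ℂ) * beurlingRhoTrunc (a j) t := by
  by_cases h1 : t ∈ Ioc (0 : ℝ) 1
  · simp only [indicator_of_mem h1, beurlingRhoTrunc, nbFun_eq]
  · simp only [indicator_of_notMem h1, beurlingRhoTrunc, mul_zero, Finset.sum_const_zero, sub_zero]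

/-- **`⟨f, e_ρ⟩` at a zero**: if `ζ(ρ) = 0` with `Re ρ > 0`, `ρ ≠ 1`, and `a_k ≥ 1`, then
`∫_0^1 f(t) t^{ρ-1} dt = 1/ρ - κ/(ρ-1)`, `κ = Σ c_k/a_k` (the Dirichlet polynomial drops out: Burnol
2004, §5, "`t^{-ρ}` … satisfy formally the perpendicularity condition"). [folklore] -/
theorem mellin_indicator_nbFun_eq (ha : ∀ j, 1 ≤ a j) {ρ : ℂ} (hρ0 : 0 < ρ.re) (hρ1 : ρ ≠ 1)
    (hζ : riemannZeta ρ = 0) :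
    mellin ((Ioc (0 : ℝ) 1).indicator (nbFun a c)) ρ = 1 / ρ - ((∑ j, c j / a j : ℝ) : ℂ) / (ρ - 1) := by
  have h1 : HasMellin ((Ioc (0 : ℝ) 1).indicator fun _ ↦ (1 : ℂ)) ρ (1 / ρ) := hasMellin_one_Ioc hρ0
  have h2 : HasMellin (fun t ↦ ∑ j, (c j : ℂ) * beurlingRhoTrunc (a j) t) ρ
      (∑ j, (c j : ℂ) * (1 / ((a j : ℂ) * (ρ - 1)) - (a j : ℂ) ^ (-ρ) * riemannZeta ρ / ρ)) :=
    HasMellin.finset_sum _ fun j _ ↦ HasMellin.const_mul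
      ⟨mellinConvergent_beurlingRhoTrunc (a j) hρ0, mellin_beurlingRhoTrunc_eq (ha j) hρ0 hρ1⟩ _
  have h := h1.sub h2
  have hfun : (fun t ↦ (Ioc (0 : ℝ) 1).indicator (fun _ ↦ (1 : ℂ)) t -
      ∑ j, (c j : ℂ) * beurlingRhoTrunc (a j) t) = (Ioc (0 : ℝ) 1).indicator (nbFun a c) :=
    funext fun t ↦ (indicator_nbFun_eq a c t).symm
  rw [hfun] at h
  rw [h.2, hζ]
  simp only [mul_zero, zero_div, sub_zero]
  push_cast
  rw [Finset.sum_div]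
  congr 1
  refine Finset.sum_congr rfl fun j _ ↦ ?_
  have haj : (a j : ℂ) ≠ 0 := by exact_mod_cast (by linarith [ha j] : (a j) ≠ 0)
  have hρ1' : ρ - 1 ≠ 0 := sub_ne_zero.2 hρ1
  field_simp

/-- On `(1,∞)`, `f(t) = -κ/t`, `κ = Σ c_k/a_k` (all `a_k ≥ 1`). [folklore] -/
lemma nbFun_of_one_lt (ha : ∀ j, 1 ≤ a j) {t : ℝ} (ht : 1 < t) :
    nbFun a c t = (((-(∑ j, c j / a j) * t⁻¹ : ℝ)) : ℂ) := by
  have ht0 : 0 < t := by linarith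
  unfold nbFun
  congr 1
  have hxm : t ∉ Ioc (0 : ℝ) 1 := fun h' ↦ absurd h'.2 (not_le.2 ht)
  simp only [indicator_of_notMem hxm, zero_sub, neg_mul, Finset.sum_mul, neg_inj]
  refine Finset.sum_congr rfl fun j _ ↦ ?_
  have hk : (0 : ℝ) < a j := by linarith [ha j]
  rw [Int.fract_eq_self.2 ⟨by positivity, ?_⟩]
  · field_simp
  · rw [div_lt_one (by positivity)]; nlinarith [ha j]

/-- **`|κ| ≤ ‖f‖₂`**: `κ² = ∫_1^∞ |f|² ≤ ∫_0^∞ |f|²`. [folklore] -/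
theorem kappa_sq_le (ha : ∀ j, 1 ≤ a j) :
    (∑ j, c j / a j) ^ 2 ≤ ∫ t in Ioi (0 : ℝ), ‖nbFun a c t‖ ^ 2 := by
  have htail : ∫ t in Ioi (1 : ℝ), ‖nbFun a c t‖ ^ 2 = (∑ j, c j / a j) ^ 2 := by
    have e : ∀ t ∈ Ioi (1 : ℝ), ‖nbFun a c t‖ ^ 2 = (∑ j, c j / a j) ^ 2 * t ^ (-2 : ℝ) := by
      intro t ht
      have ht1 : 1 < t := ht
      have ht0 : 0 < t := by linarith
      rw [nbFun_of_one_lt a c ha ht, Complex.norm_real, Real.norm_eq_abs, sq_abs, Real.rpow_neg ht0.le,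
        show (2 : ℝ) = (2 : ℕ) by norm_num, Real.rpow_natCast]
      field_simp
    rw [setIntegral_congr_fun measurableSet_Ioi e, integral_const_mul,
      integral_Ioi_rpow_of_lt (by norm_num) zero_lt_one]
    norm_num
  rw [← htail]
  exact setIntegral_mono_set (integrableOn_norm_sq_nbFun a c ha)
    (Eventually.of_forall fun t ↦ by positivity) (Eventually.of_forall (Ioi_subset_Ioi zero_le_one))

/-! ## Step 2: the key estimate in the limit `η → 0+` -/

/-- `f` is bounded: `‖f(t)‖ ≤ 1 + Σ |c_k|`. [folklore] -/
lemma norm_nbFun_le (t : ℝ) : ‖nbFun a c t‖ ≤ 1 + ∑ j, |c j| := by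
  rw [nbFun_eq]
  refine (norm_sub_le _ _).trans (add_le_add ?_ ?_)
  · by_cases h1 : t ∈ Ioc (0 : ℝ) 1 <;> simp [h1]
  · refine (norm_sum_le _ _).trans (Finset.sum_le_sum fun j _ ↦ ?_)
    rw [norm_mul, Complex.norm_real, Complex.norm_real, Real.norm_eq_abs, Real.norm_eq_abs,
      abs_of_nonneg (Int.fract_nonneg (1 / (a j * t)))]
    exact mul_le_of_le_one_right (abs_nonneg _) (Int.fract_lt_one _).le

/-- `f♯` is bounded on `(0,∞)`: `‖f♯(t)‖ ≤ 2 + Σ |c_k|` for `t > 0`. [folklore] -/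
lemma norm_nbDual_le {t : ℝ} (ht : 0 < t) (ha : ∀ j, 0 < a j) : ‖nbDual a c t‖ ≤ 2 + ∑ j, |c j| := by
  unfold nbDual
  refine (norm_sub_le _ _).trans (add_le_add (Literature.Analysis.SpecialFunctions.norm_sincKernel_le_two t) ?_)
  refine (norm_sum_le _ _).trans (Finset.sum_le_sum fun j _ ↦ ?_)
  rw [norm_mul, Complex.norm_real, Real.norm_eq_abs]
  exact mul_le_of_le_one_right (abs_nonneg _) (norm_fractDiv_le_one (mul_pos (ha j) ht).le)

/-- **The key estimate at the zero.** Let `ρ = 1/2 + iγ` and `a_k ≥ 1`. With `G = M[f𝟙_{(0,1]}]`,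
`G♯ = M[f♯𝟙_{(0,1]}]`, there is `M > 0` depending only on `γ` (through the Lipschitz constant of `U`
near `ρ`) such that `‖G(ρ) - G♯(ρ)/U(ρ)‖ ≤ ‖f‖₂ √M` — the limit `η → 0+` of
`Literature.NumberTheory.LFunctions.BaezDuarteU.norm_pairing_sub_le`. [folklore] -/
theorem norm_mellin_sub_le {γ K : ℝ} (hK : 0 < K)
    (hLip : ∀ x ∈ closedBall (1 / 2 + γ * I : ℂ) (1 / 4), ∀ y ∈ closedBall (1 / 2 + γ * I : ℂ) (1 / 4),
      ‖uSymbol y - uSymbol x‖ ≤ K * ‖y - x‖) (ha : ∀ j, 1 ≤ a j) :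
    ‖mellin ((Ioc (0 : ℝ) 1).indicator (nbFun a c)) (1 / 2 + γ * I) -
        (uSymbol (1 / 2 + γ * I))⁻¹ * mellin ((Ioc (0 : ℝ) 1).indicator (nbDual a c)) (1 / 2 + γ * I)‖ ≤
      Real.sqrt (∫ t in Ioi (0 : ℝ), ‖nbFun a c t‖ ^ 2) * Real.sqrt (max (4 * K ^ 2) 77) := by
  set ρ : ℂ := 1 / 2 + γ * I with hρ
  have hρre : ρ.re = 1 / 2 := by simp [hρ]
  have hρ0 : 0 < ρ.re := by rw [hρre]; norm_num
  have ha0 : ∀ j, 0 < a j := fun j ↦ by linarith [ha j]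
  -- the functions of `η`
  set Gf : ℂ → ℂ := mellin ((Ioc (0 : ℝ) 1).indicator (nbFun a c)) with hGf
  set Gd : ℂ → ℂ := mellin ((Ioc (0 : ℝ) 1).indicator (nbDual a c)) with hGd
  set T : ℝ → ℂ := fun η ↦ Gf (ρ + η) - (uSymbol (ρ + η))⁻¹ * Gd (ρ + η) with hT
  -- (i) `T η → T 0`-like limit
  have hbdF : ∀ t ∈ Ioc (0 : ℝ) 1, ‖nbFun a c t‖ ≤ 1 + ∑ j, |c j| := fun t _ ↦ norm_nbFun_le a c t
  have hbdD : ∀ t ∈ Ioc (0 : ℝ) 1, ‖nbDual a c t‖ ≤ 2 + ∑ j, |c j| :=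
    fun t ht ↦ norm_nbDual_le a c ht.1 ha0
  have hlimF := tendsto_mellin_indicator (measurable_nbFun a c) hbdF hρ0
  have hlimD := tendsto_mellin_indicator (measurable_nbDual a c) hbdD hρ0
  have hU0 : uSymbol ρ ≠ 0 := uSymbol_ne_zero hρ0 (by rw [hρre]; norm_num)
  have hlimU : Tendsto (fun η : ℝ ↦ (uSymbol (ρ + η))⁻¹) (𝓝[>] 0) (𝓝 ((uSymbol ρ)⁻¹)) := by
    have hc : ContinuousAt uSymbol ρ := (differentiableAt_uSymbol hρ0 (by rw [hρre]; norm_num)).continuousAt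
    have h2 : Tendsto (fun η : ℝ ↦ ρ + (η : ℂ)) (𝓝 0) (𝓝 ρ) := by
      have : Continuous fun η : ℝ ↦ ρ + (η : ℂ) := by fun_prop
      simpa using this.tendsto 0
    exact ((hc.tendsto.comp h2).inv₀ hU0).mono_left nhdsWithin_le_nhds
  have hlimT : Tendsto T (𝓝[>] 0) (𝓝 (Gf ρ - (uSymbol ρ)⁻¹ * Gd ρ)) :=
    hlimF.sub (hlimU.mul hlimD)
  -- (ii) the uniform bound for small `η > 0`
  set d : ℝ := Real.sqrt (∫ t in Ioi (0 : ℝ), ‖nbFun a c t‖ ^ 2) with hd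
  have hUρ : ‖uSymbol ρ‖ = 1 := norm_uSymbol_half γ
  have hρD : ρ ∈ closedBall ρ (1 / 4) := mem_closedBall_self (by norm_num)
  have hbound : ∀ᶠ η in 𝓝[>] (0 : ℝ), ‖T η‖ ≤ d * Real.sqrt (max (4 * K ^ 2) 77) := by
    have hη1 : (0 : ℝ) < min (1 / 4) (1 / (4 * K)) := by positivity
    filter_upwards [Ioo_mem_nhdsGT hη1] with η hη
    have hη0 : 0 < η := hη.1
    have hηa : η ≤ 1 / 4 := (hη.2.le.trans (min_le_left _ _))
    have hηb : η ≤ 1 / (4 * K) := (hη.2.le.trans (min_le_right _ _))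
    -- `‖U(ρ+η)‖ ≥ 1/2`
    have hwD : ρ + η ∈ closedBall ρ (1 / 4) := by
      rw [mem_closedBall, dist_eq_norm, add_sub_cancel_left, Complex.norm_real, Real.norm_eq_abs,
        abs_of_pos hη0]
      exact hηa
    have hUw : 1 / 2 ≤ ‖uSymbol (ρ + η)‖ := by
      have h1 := hLip ρ hρD (ρ + η) hwD
      rw [add_sub_cancel_left, Complex.norm_real, Real.norm_eq_abs, abs_of_pos hη0] at h1
      have h2 : K * η ≤ 1 / 4 := by
        rw [le_div_iff₀ (by positivity)] at hηb; linarith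
      have h3 : ‖uSymbol ρ‖ - ‖uSymbol (ρ + η) - uSymbol ρ‖ ≤ ‖uSymbol (ρ + η)‖ := by
        have := norm_sub_norm_le (uSymbol ρ) (uSymbol ρ - uSymbol (ρ + η))
        rw [sub_sub_cancel, norm_sub_rev] at this
        linarith
      linarith
    have hkey := norm_pairing_sub_le a c ha hK hLip hη0 hηa hUw
    -- identify the pairing with `T η`
    have hpair : ∫ t in Ioi (0 : ℝ), (nbFun a c t - (uSymbol (ρ + η))⁻¹ * nbDual a c t) *
        conj (testVec (ρ + η) t) = T η := by
      have hwre : 0 < (ρ + (η : ℂ)).re := by simp [hρ]; linarith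
      rw [integral_mul_conj_testVec]
      have h1 : HasMellin ((Ioc (0 : ℝ) 1).indicator (nbFun a c)) (ρ + η) (Gf (ρ + η)) :=
        ⟨mellinConvergent_indicator (measurable_nbFun a c) hbdF hwre, rfl⟩
      have h2 : HasMellin ((Ioc (0 : ℝ) 1).indicator (nbDual a c)) (ρ + η) (Gd (ρ + η)) :=
        ⟨mellinConvergent_indicator (measurable_nbDual a c) hbdD hwre, rfl⟩
      have h3 := h1.sub (h2.const_mul ((uSymbol (ρ + η))⁻¹))
      have e : (Ioc (0 : ℝ) 1).indicator (fun t ↦ nbFun a c t - (uSymbol (ρ + η))⁻¹ * nbDual a c t) =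
          fun t ↦ (Ioc (0 : ℝ) 1).indicator (nbFun a c) t -
            (uSymbol (ρ + η))⁻¹ * (Ioc (0 : ℝ) 1).indicator (nbDual a c) t := by
        funext t
        by_cases h1 : t ∈ Ioc (0 : ℝ) 1
        · simp only [indicator_of_mem h1]
        · simp only [indicator_of_notMem h1, mul_zero, sub_zero]
      rw [e, h3.2]
    rw [← hpair, hρ]
    exact hkey
  -- (iii) pass to the limit
  have := le_of_tendsto hlimT.norm hbound
  simpa [hGf, hGd] using this

/-! ## Step 3: the truncated pairing `⟨f♯, e_ρ⟩` -/

/-- On `(0,θ]` with `a_k θ < 1` for all `k`: `f♯(t) = sin(2πt)/(πt) - Σ c_k` (all `{a_k t}/(a_k t) = 1`).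
[folklore] -/
lemma nbDual_of_small (ha : ∀ j, 0 < a j) {θ t : ℝ} (hθ : ∀ j, a j * θ < 1) (ht0 : 0 < t) (ht : t ≤ θ) :
    nbDual a c t = Literature.Analysis.SpecialFunctions.sincKernel t - ∑ j, (c j : ℂ) := by
  unfold nbDual
  congr 1
  refine Finset.sum_congr rfl fun j _ ↦ ?_
  rw [fractDiv_eq_one (mul_pos (ha j) ht0), mul_one]
  calc a j * t ≤ a j * θ := by gcongr; linarith [ha j]
    _ < 1 := hθ j

/-- **The head of `⟨f♯, e_ρ⟩`**: for `Re ρ = 1/2`, `0 < θ ≤ 1`, `a_k θ < 1`: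
`‖∫_{(0,θ]} t^{ρ-1} f♯‖ ≤ 2√θ (2 + |Σ c_k|)`. [folklore] -/
theorem norm_head_le (ha : ∀ j, 0 < a j) {ρ : ℂ} (hρ : ρ.re = 1 / 2) {θ : ℝ} (hθ0 : 0 < θ)
    (hθ : ∀ j, a j * θ < 1) :
    ‖∫ t in Ioc (0 : ℝ) θ, (t : ℂ) ^ (ρ - 1) * nbDual a c t‖ ≤
      2 * Real.sqrt θ * (2 + ‖∑ j, (c j : ℂ)‖) := by
  set P0 : ℂ := ∑ j, (c j : ℂ) with hP0
  have hpt : ∀ t ∈ Ioc (0 : ℝ) θ, ‖(t : ℂ) ^ (ρ - 1) * nbDual a c t‖ ≤ (2 + ‖P0‖) * t ^ (-(1 / 2) : ℝ) := by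
    intro t ht
    rw [norm_mul, norm_cpow_eq_rpow_re_of_pos ht.1, sub_re, hρ, one_re,
      show (1 / 2 - 1 : ℝ) = -(1 / 2) by norm_num, nbDual_of_small a c ha hθ ht.1 ht.2, mul_comm]
    refine mul_le_mul_of_nonneg_right ?_ (Real.rpow_nonneg ht.1.le _)
    exact (norm_sub_le _ _).trans (add_le_add (Literature.Analysis.SpecialFunctions.norm_sincKernel_le_two t) le_rfl)
  have hint : IntegrableOn (fun t : ℝ ↦ (2 + ‖P0‖) * t ^ (-(1 / 2) : ℝ)) (Ioc 0 θ) :=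
    ((intervalIntegral.intervalIntegrable_rpow' (a := 0) (b := θ) (by norm_num)).1).const_mul _
  have hval : ∫ t in Ioc (0 : ℝ) θ, (2 + ‖P0‖) * t ^ (-(1 / 2) : ℝ) = (2 + ‖P0‖) * (2 * Real.sqrt θ) := by
    rw [integral_const_mul, ← intervalIntegral.integral_of_le hθ0.le, integral_rpow (Or.inl (by norm_num))]
    congr 1
    rw [Real.zero_rpow (by norm_num), sub_zero, Real.sqrt_eq_rpow]
    ring_nf
  calc ‖∫ t in Ioc (0 : ℝ) θ, (t : ℂ) ^ (ρ - 1) * nbDual a c t‖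
      ≤ ∫ t in Ioc (0 : ℝ) θ, ‖(t : ℂ) ^ (ρ - 1) * nbDual a c t‖ := norm_integral_le_integral_norm _
    _ ≤ ∫ t in Ioc (0 : ℝ) θ, (2 + ‖P0‖) * t ^ (-(1 / 2) : ℝ) := by
        refine integral_mono_of_nonneg (Eventually.of_forall fun t ↦ norm_nonneg _) hint ?_
        exact (ae_restrict_iff' measurableSet_Ioc).2 (Eventually.of_forall hpt)
    _ = 2 * Real.sqrt θ * (2 + ‖P0‖) := by rw [hval]; ring

/-- **The tail of `⟨f♯, e_ρ⟩`** (Cauchy–Schwarz): for `Re ρ = 1/2`, `0 < θ ≤ 1`, `a_k ≥ 1`: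
`‖∫_{(θ,1]} t^{ρ-1} f♯‖ ≤ √log(1/θ) · ‖f♯‖₂ = √log(1/θ) · ‖f‖₂`. [folklore] -/
theorem norm_tail_le (ha : ∀ j, 1 ≤ a j) {ρ : ℂ} (hρ : ρ.re = 1 / 2) {θ : ℝ} (hθ0 : 0 < θ) (hθ1 : θ ≤ 1) :
    ‖∫ t in Ioc θ 1, (t : ℂ) ^ (ρ - 1) * nbDual a c t‖ ≤
      Real.sqrt (Real.log (1 / θ)) * Real.sqrt (∫ t in Ioi (0 : ℝ), ‖nbFun a c t‖ ^ 2) := by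
  have hsub : Ioc θ 1 ⊆ Ioi 0 := fun t ht ↦ lt_trans hθ0 ht.1
  -- the two `L²` functions on `(θ,1]`
  have hf1 : ∀ t ∈ Ioc θ 1, ‖(t : ℂ) ^ (ρ - 1)‖ = t ^ (-(1 / 2) : ℝ) := by
    intro t ht
    rw [norm_cpow_eq_rpow_re_of_pos (lt_trans hθ0 ht.1), sub_re, hρ, one_re]
    norm_num
  have hInv : IntegrableOn (fun t : ℝ ↦ t⁻¹) (Ioc θ 1) := by
    have := (intervalIntegral.intervalIntegrable_inv (μ := volume) (a := θ) (b := 1) (f := id)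
      (fun x hx ↦ by
        rw [uIcc_of_le hθ1] at hx; exact (ne_of_gt (lt_of_lt_of_le hθ0 hx.1)))
      continuousOn_id).1
    simpa using this
  have hpow : EqOn (fun t : ℝ ↦ ‖(t : ℂ) ^ (ρ - 1)‖ ^ 2) (fun t : ℝ ↦ t⁻¹) (Ioc θ 1) := by
    intro t ht
    simp only
    rw [hf1 t ht, ← Real.rpow_natCast, ← Real.rpow_mul (lt_trans hθ0 ht.1).le,
      show (-(1 / 2 : ℝ)) * ((2 : ℕ) : ℝ) = -1 by norm_num, Real.rpow_neg_one]
  have hsq1 : IntegrableOn (fun t : ℝ ↦ ‖(t : ℂ) ^ (ρ - 1)‖ ^ 2) (Ioc θ 1) :=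
    hInv.congr_fun hpow.symm measurableSet_Ioc
  have hsq2 : IntegrableOn (fun t : ℝ ↦ ‖nbDual a c t‖ ^ 2) (Ioc θ 1) :=
    (integrableOn_norm_sq_nbDual a c ha).mono_set hsub
  have hm1 : AEStronglyMeasurable (fun t : ℝ ↦ ‖(t : ℂ) ^ (ρ - 1)‖) (volume.restrict (Ioc θ 1)) :=
    (Complex.measurable_ofReal.pow_const _).norm.aestronglyMeasurable
  have hm2 : AEStronglyMeasurable (fun t : ℝ ↦ ‖nbDual a c t‖) (volume.restrict (Ioc θ 1)) :=
    (measurable_nbDual a c).norm.aestronglyMeasurable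
  have hCS : ∫ t in Ioc θ 1, ‖(t : ℂ) ^ (ρ - 1)‖ * ‖nbDual a c t‖ ≤
      (∫ t in Ioc θ 1, ‖(t : ℂ) ^ (ρ - 1)‖ ^ 2) ^ (1 / 2 : ℝ) *
        (∫ t in Ioc θ 1, ‖nbDual a c t‖ ^ 2) ^ (1 / 2 : ℝ) := by
    have h := integral_mul_le_Lp_mul_Lq_of_nonneg (μ := volume.restrict (Ioc θ 1))
      Real.HolderConjugate.two_two
      (f := fun t : ℝ ↦ ‖(t : ℂ) ^ (ρ - 1)‖) (g := fun t : ℝ ↦ ‖nbDual a c t‖)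
      (Eventually.of_forall fun t ↦ norm_nonneg _) (Eventually.of_forall fun t ↦ norm_nonneg _)
      (by
        rw [ENNReal.ofReal_ofNat]
        refine (memLp_two_iff_integrable_sq_norm hm1).2 ?_
        simp only [norm_norm]
        exact hsq1)
      (by
        rw [ENNReal.ofReal_ofNat]
        refine (memLp_two_iff_integrable_sq_norm hm2).2 ?_
        simp only [norm_norm]
        exact hsq2)
    simpa only [Real.rpow_two] using h
  -- the two factors
  have hA : ∫ t in Ioc θ 1, ‖(t : ℂ) ^ (ρ - 1)‖ ^ 2 = Real.log (1 / θ) := by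
    rw [setIntegral_congr_fun measurableSet_Ioc hpow, ← intervalIntegral.integral_of_le hθ1,
      integral_inv_of_pos hθ0 zero_lt_one]
  have hB : ∫ t in Ioc θ 1, ‖nbDual a c t‖ ^ 2 ≤ ∫ t in Ioi (0 : ℝ), ‖nbFun a c t‖ ^ 2 := by
    rw [← integral_norm_sq_nbDual_eq a c ha]
    exact setIntegral_mono_set (integrableOn_norm_sq_nbDual a c ha)
      (Eventually.of_forall fun t ↦ by positivity) (Eventually.of_forall hsub)
  calc ‖∫ t in Ioc θ 1, (t : ℂ) ^ (ρ - 1) * nbDual a c t‖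
      ≤ ∫ t in Ioc θ 1, ‖(t : ℂ) ^ (ρ - 1) * nbDual a c t‖ := norm_integral_le_integral_norm _
    _ = ∫ t in Ioc θ 1, ‖(t : ℂ) ^ (ρ - 1)‖ * ‖nbDual a c t‖ := by simp_rw [norm_mul]
    _ ≤ (∫ t in Ioc θ 1, ‖(t : ℂ) ^ (ρ - 1)‖ ^ 2) ^ (1 / 2 : ℝ) *
        (∫ t in Ioc θ 1, ‖nbDual a c t‖ ^ 2) ^ (1 / 2 : ℝ) := hCS
    _ ≤ Real.sqrt (Real.log (1 / θ)) * Real.sqrt (∫ t in Ioi (0 : ℝ), ‖nbFun a c t‖ ^ 2) := by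
        rw [← Real.sqrt_eq_rpow, ← Real.sqrt_eq_rpow, hA]
        exact mul_le_mul_of_nonneg_left (Real.sqrt_le_sqrt hB) (Real.sqrt_nonneg _)

/-- **Size of `P(0) = Σ c_k`**: for `θ' > 0` with `a_k θ' < 1`,
`|Σ c_k|² ≤ 8 + 2‖f‖₂²/θ'` (from `f♯ = sin(2πt)/(πt) - Σ c_k` on `(0,θ']` and `‖f♯‖₂ = ‖f‖₂`).
[folklore] -/
theorem norm_sum_sq_le (ha : ∀ j, 1 ≤ a j) {θ' : ℝ} (hθ0 : 0 < θ') (hθ : ∀ j, a j * θ' < 1) :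
    ‖∑ j, (c j : ℂ)‖ ^ 2 ≤ 8 + 2 * (∫ t in Ioi (0 : ℝ), ‖nbFun a c t‖ ^ 2) / θ' := by
  set P0 : ℂ := ∑ j, (c j : ℂ) with hP0
  set D2 : ℝ := ∫ t in Ioi (0 : ℝ), ‖nbFun a c t‖ ^ 2 with hD2
  have ha0 : ∀ j, 0 < a j := fun j ↦ by linarith [ha j]
  have hsub : Ioc (0 : ℝ) θ' ⊆ Ioi 0 := fun t ht ↦ ht.1
  have hpt : ∀ t ∈ Ioc (0 : ℝ) θ', ‖P0‖ ^ 2 ≤ 8 + 2 * ‖nbDual a c t‖ ^ 2 := by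
    intro t ht
    have h1 : P0 = Literature.Analysis.SpecialFunctions.sincKernel t - nbDual a c t := by
      rw [nbDual_of_small a c ha0 hθ ht.1 ht.2]; ring
    have h2 : ‖P0‖ ≤ 2 + ‖nbDual a c t‖ := by
      rw [h1]
      exact (norm_sub_le _ _).trans (add_le_add (Literature.Analysis.SpecialFunctions.norm_sincKernel_le_two t) le_rfl)
    have h3 : ‖P0‖ ^ 2 ≤ (2 + ‖nbDual a c t‖) ^ 2 := pow_le_pow_left₀ (norm_nonneg _) h2 2
    nlinarith [sq_nonneg (‖nbDual a c t‖ - 2)]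
  have hc8 : IntegrableOn (fun _ : ℝ ↦ (8 : ℝ)) (Ioc 0 θ') := integrableOn_const measure_Ioc_lt_top.ne
  have hcP : IntegrableOn (fun _ : ℝ ↦ ‖P0‖ ^ 2) (Ioc 0 θ') := integrableOn_const measure_Ioc_lt_top.ne
  have hI2 : IntegrableOn (fun t : ℝ ↦ 2 * ‖nbDual a c t‖ ^ 2) (Ioc 0 θ') :=
    ((integrableOn_norm_sq_nbDual a c ha).mono_set hsub).const_mul 2
  have hI : IntegrableOn (fun t : ℝ ↦ 8 + 2 * ‖nbDual a c t‖ ^ 2) (Ioc 0 θ') := hc8.add hI2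
  have h1 : ∫ _ in Ioc (0 : ℝ) θ', ‖P0‖ ^ 2 ≤ ∫ t in Ioc (0 : ℝ) θ', (8 + 2 * ‖nbDual a c t‖ ^ 2) :=
    setIntegral_mono_on hcP hI measurableSet_Ioc hpt
  have h2 : ∫ t in Ioc (0 : ℝ) θ', (8 + 2 * ‖nbDual a c t‖ ^ 2) ≤ 8 * θ' + 2 * D2 := by
    rw [integral_add hc8 hI2, setIntegral_const, integral_const_mul, Real.volume_real_Ioc_of_le hθ0.le,
      sub_zero, smul_eq_mul, mul_comm]
    have : ∫ t in Ioc (0 : ℝ) θ', ‖nbDual a c t‖ ^ 2 ≤ D2 := by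
      rw [hD2, ← integral_norm_sq_nbDual_eq a c ha]
      exact setIntegral_mono_set (integrableOn_norm_sq_nbDual a c ha)
        (Eventually.of_forall fun t ↦ by positivity) (Eventually.of_forall hsub)
    linarith
  rw [setIntegral_const, Real.volume_real_Ioc_of_le hθ0.le, sub_zero, smul_eq_mul] at h1
  have h3 : θ' * ‖P0‖ ^ 2 ≤ 8 * θ' + 2 * D2 := h1.trans h2
  have e : 8 + 2 * D2 / θ' = (8 * θ' + 2 * D2) / θ' := by field_simp
  rw [e, le_div_iff₀ hθ0]
  linarith

/-! ## Step 4: assembly -/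

/-- **`|P(0)| = |Σ c_k| ≤ 2√2 + 2√N ‖f‖₂`** for dilations `1 ≤ a_k ≤ N` (take `θ' = 1/(2N)` in
`norm_sum_sq_le`). [folklore] -/
theorem norm_sum_le {N : ℝ} (haN : ∀ j, 1 ≤ a j ∧ a j ≤ N) (hN : 1 ≤ N) :
    ‖∑ j, (c j : ℂ)‖ ≤ 2 * Real.sqrt 2 +
      2 * Real.sqrt N * Real.sqrt (∫ t in Ioi (0 : ℝ), ‖nbFun a c t‖ ^ 2) := by
  set D2 : ℝ := ∫ t in Ioi (0 : ℝ), ‖nbFun a c t‖ ^ 2 with hD2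
  set d : ℝ := Real.sqrt D2 with hd
  have hD2nn : 0 ≤ D2 := integral_nonneg fun t ↦ by positivity
  have hd0 : 0 ≤ d := Real.sqrt_nonneg _
  have hN0 : 0 < N := by linarith
  have hθ' : ∀ j, a j * (1 / (2 * N)) < 1 := by
    intro j
    calc a j * (1 / (2 * N)) ≤ N * (1 / (2 * N)) := by gcongr; exact (haN j).2
      _ = 1 / 2 := by field_simp
      _ < 1 := by norm_num
  have h1 := norm_sum_sq_le a c (fun j ↦ (haN j).1) (by positivity : (0 : ℝ) < 1 / (2 * N)) hθ'
  have h2 : ‖∑ j, (c j : ℂ)‖ ^ 2 ≤ 8 + 4 * N * d ^ 2 := by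
    rw [hd, Real.sq_sqrt hD2nn]
    calc ‖∑ j, (c j : ℂ)‖ ^ 2 ≤ 8 + 2 * D2 / (1 / (2 * N)) := h1
      _ = 8 + 4 * N * D2 := by field_simp; ring
  have h3 : ‖∑ j, (c j : ℂ)‖ ≤ Real.sqrt (8 + 4 * N * d ^ 2) :=
    (Real.le_sqrt (norm_nonneg _) (by positivity)).2 h2
  have h4 : Real.sqrt (8 + 4 * N * d ^ 2) ≤ Real.sqrt 8 + Real.sqrt (4 * N * d ^ 2) := by
    rw [Real.sqrt_le_left (by positivity)]
    nlinarith [Real.sq_sqrt (by norm_num : (0 : ℝ) ≤ 8), Real.sq_sqrt (by positivity : (0 : ℝ) ≤ 4 * N * d ^ 2),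
      Real.sqrt_nonneg 8, Real.sqrt_nonneg (4 * N * d ^ 2)]
  have h5 : Real.sqrt 8 = 2 * Real.sqrt 2 := by
    rw [show (8 : ℝ) = 2 ^ 2 * 2 by norm_num, Real.sqrt_mul (by norm_num), Real.sqrt_sq (by norm_num)]
  have h6 : Real.sqrt (4 * N * d ^ 2) = 2 * Real.sqrt N * d := by
    rw [show 4 * N * d ^ 2 = (2 ^ 2 * N) * d ^ 2 by ring, Real.sqrt_mul (by positivity),
      Real.sqrt_sq hd0, Real.sqrt_mul (by norm_num), Real.sqrt_sq (by norm_num)]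
  linarith

/-- The truncated Mellin integral of `f♯` splits at `θ ∈ (0,1]`:
`M[f♯𝟙_{(0,1]}](ρ) = ∫_{(0,θ]} t^{ρ-1}f♯ + ∫_{(θ,1]} t^{ρ-1}f♯` (`Re ρ > 0`). [folklore] -/
theorem mellin_indicator_nbDual_split (ha : ∀ j, 0 < a j) {ρ : ℂ} (hρ0 : 0 < ρ.re) {θ : ℝ}
    (hθ0 : 0 < θ) (hθ1 : θ ≤ 1) :
    mellin ((Ioc (0 : ℝ) 1).indicator (nbDual a c)) ρ =
      (∫ t in Ioc (0 : ℝ) θ, (t : ℂ) ^ (ρ - 1) * nbDual a c t) +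
        ∫ t in Ioc θ 1, (t : ℂ) ^ (ρ - 1) * nbDual a c t := by
  have hconv := mellinConvergent_indicator (measurable_nbDual a c)
    (fun t ht ↦ norm_nbDual_le a c ht.1 ha) hρ0
  have hI : IntegrableOn (fun t : ℝ ↦ (t : ℂ) ^ (ρ - 1) * nbDual a c t) (Ioc 0 1) := by
    have h1 : IntegrableOn (fun t : ℝ ↦ (t : ℂ) ^ (ρ - 1) • (Ioc (0 : ℝ) 1).indicator (nbDual a c) t)
        (Ioc 0 1) := hconv.mono_set Ioc_subset_Ioi_self
    refine h1.congr_fun (fun t ht ↦ ?_) measurableSet_Ioc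
    simp only [indicator_of_mem ht, smul_eq_mul]
  rw [mellin_indicator_eq_setIntegral, ← Ioc_union_Ioc_eq_Ioc hθ0.le hθ1,
    setIntegral_union (Ioc_disjoint_Ioc_of_le le_rfl) measurableSet_Ioc
      (hI.mono_set (Ioc_subset_Ioc le_rfl hθ1)) (hI.mono_set (Ioc_subset_Ioc hθ0.le le_rfl))]

/-- **`‖⟨f♯, e_ρ⟩‖ ≤ 10√θ₀ + 4√θ₀‖f‖₂ + (√log N + √log(1/θ₀))‖f‖₂`** for `Re ρ = 1/2`,
`1 ≤ a_k ≤ N`, `N ≥ 2`, `0 < θ₀ ≤ 1/2` (split at `θ = θ₀/N`: head, tail and `|P(0)|` bounds).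
[folklore] -/
theorem norm_mellin_indicator_nbDual_le {N : ℝ} (haN : ∀ j, 1 ≤ a j ∧ a j ≤ N) (hN : 2 ≤ N)
    {ρ : ℂ} (hρ : ρ.re = 1 / 2) {θ₀ : ℝ} (hθ₀pos : 0 < θ₀) (hθ₀le : θ₀ ≤ 1 / 2) :
    ‖mellin ((Ioc (0 : ℝ) 1).indicator (nbDual a c)) ρ‖ ≤
      10 * Real.sqrt θ₀ + 4 * Real.sqrt θ₀ * Real.sqrt (∫ t in Ioi (0 : ℝ), ‖nbFun a c t‖ ^ 2) +
        (Real.sqrt (Real.log N) + Real.sqrt (Real.log (1 / θ₀))) *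
          Real.sqrt (∫ t in Ioi (0 : ℝ), ‖nbFun a c t‖ ^ 2) := by
  set d : ℝ := Real.sqrt (∫ t in Ioi (0 : ℝ), ‖nbFun a c t‖ ^ 2) with hd
  have hd0 : 0 ≤ d := Real.sqrt_nonneg _
  have ha : ∀ j, 1 ≤ a j := fun j ↦ (haN j).1
  have ha0 : ∀ j, 0 < a j := fun j ↦ by linarith [ha j]
  have hN0 : 0 < N := by linarith
  have hρ0 : 0 < ρ.re := by rw [hρ]; norm_num
  set θ : ℝ := θ₀ / N with hθ
  have hθpos : 0 < θ := by positivity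
  have hθle1 : θ ≤ 1 := by rw [hθ, div_le_one hN0]; linarith
  have hθa : ∀ j, a j * θ < 1 := by
    intro j
    calc a j * θ ≤ N * θ := by gcongr; exact (haN j).2
      _ = θ₀ := by rw [hθ]; field_simp
      _ < 1 := by linarith
  rw [mellin_indicator_nbDual_split a c ha0 hρ0 hθpos hθle1]
  have hhead := norm_head_le a c ha0 hρ hθpos hθa
  have htail := norm_tail_le a c ha hρ hθpos hθle1
  have hP0 := norm_sum_le a c haN (by linarith)
  -- head
  have hsqrtθ : Real.sqrt θ = Real.sqrt θ₀ / Real.sqrt N := by rw [hθ, Real.sqrt_div hθ₀pos.le]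
  have hsqrtN1 : 1 ≤ Real.sqrt N := by
    rw [show (1 : ℝ) = Real.sqrt 1 by simp]; exact Real.sqrt_le_sqrt (by linarith)
  have hs2 : Real.sqrt 2 ≤ 3 / 2 := by rw [Real.sqrt_le_left (by norm_num)]; norm_num
  have hhead' : ‖∫ t in Ioc (0 : ℝ) θ, (t : ℂ) ^ (ρ - 1) * nbDual a c t‖ ≤
      10 * Real.sqrt θ₀ + 4 * Real.sqrt θ₀ * d := by
    refine hhead.trans ?_
    have hx0 : 0 ≤ Real.sqrt θ₀ := Real.sqrt_nonneg _
    have hq : 0 < Real.sqrt N := by linarith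
    -- `2 √θ (2 + |P0|) ≤ 2 (√θ₀/√N)(2 + 2√2 + 2√N d) = (4+4√2)√θ₀/√N + 4√θ₀ d`
    have e1 : 2 * Real.sqrt θ * (2 + ‖∑ j, (c j : ℂ)‖) ≤
        2 * (Real.sqrt θ₀ / Real.sqrt N) * (2 + (2 * Real.sqrt 2 + 2 * Real.sqrt N * d)) := by
      rw [hsqrtθ]; gcongr
    have e2 : 2 * (Real.sqrt θ₀ / Real.sqrt N) * (2 + (2 * Real.sqrt 2 + 2 * Real.sqrt N * d)) =
        (4 + 4 * Real.sqrt 2) * (Real.sqrt θ₀ / Real.sqrt N) + 4 * Real.sqrt θ₀ * d := by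
      field_simp
      ring
    have e3 : Real.sqrt θ₀ / Real.sqrt N ≤ Real.sqrt θ₀ := div_le_self hx0 hsqrtN1
    have e4 : (4 + 4 * Real.sqrt 2) * (Real.sqrt θ₀ / Real.sqrt N) ≤ 10 * Real.sqrt θ₀ := by
      calc (4 + 4 * Real.sqrt 2) * (Real.sqrt θ₀ / Real.sqrt N) ≤ (4 + 4 * Real.sqrt 2) * Real.sqrt θ₀ :=
            mul_le_mul_of_nonneg_left e3 (by positivity)
        _ ≤ 10 * Real.sqrt θ₀ := by nlinarith
    linarith
  -- tail
  have hlogθ : Real.log (1 / θ) = Real.log N + Real.log (1 / θ₀) := by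
    rw [hθ, one_div_div, Real.log_div hN0.ne' hθ₀pos.ne', one_div, Real.log_inv]
    ring
  have hlogN : 0 < Real.log N := Real.log_pos (by linarith)
  have hL₀ : 0 ≤ Real.log (1 / θ₀) := Real.log_nonneg (by rw [le_div_iff₀ hθ₀pos]; linarith)
  have htail' : ‖∫ t in Ioc θ 1, (t : ℂ) ^ (ρ - 1) * nbDual a c t‖ ≤
      (Real.sqrt (Real.log N) + Real.sqrt (Real.log (1 / θ₀))) * d := by
    refine htail.trans ?_
    rw [hlogθ]
    have hs : Real.sqrt (Real.log N + Real.log (1 / θ₀)) ≤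
        Real.sqrt (Real.log N) + Real.sqrt (Real.log (1 / θ₀)) := by
      rw [Real.sqrt_le_left (by positivity)]
      nlinarith [Real.sq_sqrt hlogN.le, Real.sq_sqrt hL₀, Real.sqrt_nonneg (Real.log N),
        Real.sqrt_nonneg (Real.log (1 / θ₀))]
    exact mul_le_mul_of_nonneg_right hs hd0
  exact (norm_add_le _ _).trans (add_le_add hhead' htail')

/-- **`‖⟨f, e_ρ⟩‖ ≥ (1 - ‖f‖₂)/|ρ|`** at a zero `ρ = 1/2 + iγ` of `ζ`. [folklore] -/
theorem norm_mellin_indicator_nbFun_ge (ha : ∀ j, 1 ≤ a j) {γ : ℝ} (hγ : riemannZeta (1 / 2 + γ * I) = 0) :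
    (1 - Real.sqrt (∫ t in Ioi (0 : ℝ), ‖nbFun a c t‖ ^ 2)) / ‖(1 / 2 + γ * I : ℂ)‖ ≤
      ‖mellin ((Ioc (0 : ℝ) 1).indicator (nbFun a c)) (1 / 2 + γ * I)‖ := by
  set ρ : ℂ := 1 / 2 + γ * I with hρ
  set d : ℝ := Real.sqrt (∫ t in Ioi (0 : ℝ), ‖nbFun a c t‖ ^ 2) with hd
  have hρre : ρ.re = 1 / 2 := by simp [hρ]
  have hρ0 : 0 < ρ.re := by rw [hρre]; norm_num
  have hρn0 : ρ ≠ 0 := fun h ↦ by simp [h] at hρ0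
  have hρ1 : ρ ≠ 1 := fun h ↦ by rw [h] at hρre; simp at hρre
  have hrpos : 0 < ‖ρ‖ := norm_pos_iff.2 hρn0
  have hr1 : ‖ρ - 1‖ = ‖ρ‖ := by
    have e1 : ‖ρ - 1‖ ^ 2 = 1 / 4 + γ ^ 2 := by
      rw [← Complex.normSq_eq_norm_sq, hρ,
        show (1 / 2 + γ * I - 1 : ℂ) = ((-(1 / 2) : ℝ) : ℂ) + (γ : ℝ) * I by push_cast; ring,
        Complex.normSq_add_mul_I]
      norm_num
    have e2 : ‖ρ‖ ^ 2 = 1 / 4 + γ ^ 2 := by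
      rw [← Complex.normSq_eq_norm_sq, hρ,
        show (1 / 2 + γ * I : ℂ) = ((1 / 2 : ℝ) : ℂ) + (γ : ℝ) * I by push_cast; ring,
        Complex.normSq_add_mul_I]
      norm_num
    exact (sq_eq_sq₀ (norm_nonneg _) (norm_nonneg _)).1 (e1.trans e2.symm)
  rw [mellin_indicator_nbFun_eq a c ha hρ0 hρ1 hγ]
  have hκ : |∑ j, c j / a j| ≤ d := by
    rw [← Real.sqrt_sq_eq_abs]
    exact Real.sqrt_le_sqrt (kappa_sq_le a c ha)
  have h1 : ‖(1 : ℂ) / ρ‖ = 1 / ‖ρ‖ := by rw [norm_div, norm_one]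
  have h2 : ‖((∑ j, c j / a j : ℝ) : ℂ) / (ρ - 1)‖ ≤ d / ‖ρ‖ := by
    rw [norm_div, hr1, Complex.norm_real, Real.norm_eq_abs]
    exact div_le_div_of_nonneg_right hκ hrpos.le
  have h3 := norm_sub_norm_le ((1 : ℂ) / ρ) (((∑ j, c j / a j : ℝ) : ℂ) / (ρ - 1))
  rw [h1] at h3
  rw [sub_div]
  linarith

/-- **The core inequality** at a zero `ρ = 1/2 + iγ`: with `d = ‖f‖₂`, `r = |ρ|`,
`M = max(4K², 77)` (`K` a Lipschitz constant of `U` near `ρ`) and any `0 < θ₀ ≤ 1/2`,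
`(1-d)/r ≤ d√M + 10√θ₀ + 4√θ₀ d + (√log N + √log(1/θ₀)) d`. [folklore] -/
theorem core_ineq {γ K : ℝ} (hγ : riemannZeta (1 / 2 + γ * I) = 0) (hK : 0 < K)
    (hLip : ∀ x ∈ closedBall (1 / 2 + γ * I : ℂ) (1 / 4), ∀ y ∈ closedBall (1 / 2 + γ * I : ℂ) (1 / 4),
      ‖uSymbol y - uSymbol x‖ ≤ K * ‖y - x‖)
    {N : ℝ} (haN : ∀ j, 1 ≤ a j ∧ a j ≤ N) (hN : 2 ≤ N) {θ₀ : ℝ} (hθ₀pos : 0 < θ₀) (hθ₀le : θ₀ ≤ 1 / 2) :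
    (1 - Real.sqrt (∫ t in Ioi (0 : ℝ), ‖nbFun a c t‖ ^ 2)) / ‖(1 / 2 + γ * I : ℂ)‖ ≤
      Real.sqrt (∫ t in Ioi (0 : ℝ), ‖nbFun a c t‖ ^ 2) * Real.sqrt (max (4 * K ^ 2) 77) +
      (10 * Real.sqrt θ₀ + 4 * Real.sqrt θ₀ * Real.sqrt (∫ t in Ioi (0 : ℝ), ‖nbFun a c t‖ ^ 2) +
        (Real.sqrt (Real.log N) + Real.sqrt (Real.log (1 / θ₀))) *
          Real.sqrt (∫ t in Ioi (0 : ℝ), ‖nbFun a c t‖ ^ 2)) := by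
  have ha : ∀ j, 1 ≤ a j := fun j ↦ (haN j).1
  set ρ : ℂ := 1 / 2 + γ * I with hρ
  set Gf : ℂ := mellin ((Ioc (0 : ℝ) 1).indicator (nbFun a c)) ρ with hGf
  set Gd : ℂ := mellin ((Ioc (0 : ℝ) 1).indicator (nbDual a c)) ρ with hGd
  have hρre : ρ.re = 1 / 2 := by simp [hρ]
  have hlow : _ ≤ ‖Gf‖ := norm_mellin_indicator_nbFun_ge a c ha hγ
  have hkey : ‖Gf - (uSymbol ρ)⁻¹ * Gd‖ ≤ _ := norm_mellin_sub_le a c hK hLip ha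
  have hUρ : ‖uSymbol ρ‖ = 1 := norm_uSymbol_half γ
  have hGd : ‖Gd‖ ≤ _ := norm_mellin_indicator_nbDual_le a c haN hN hρre hθ₀pos hθ₀le
  have h1 := norm_sub_norm_le Gf ((uSymbol ρ)⁻¹ * Gd)
  rw [norm_mul, norm_inv, hUρ, inv_one, one_mul] at h1
  linarith

/-- The constants: pure real arithmetic turning `core_ineq` into `C/x ≤ d` (`x = √log N ≥ √log 2`).
[folklore] -/
lemma const_step {r M θ₀ L d x : ℝ} (hr : 0 < r) (hd : 0 ≤ d)
    (hx : Real.sqrt (Real.log 2) ≤ x) (hθ : 10 * Real.sqrt θ₀ ≤ 1 / (2 * r))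
    (hmain : (1 - d) / r ≤ d * Real.sqrt M + (10 * Real.sqrt θ₀ + 4 * Real.sqrt θ₀ * d + (x + Real.sqrt L) * d)) :
    1 / (2 * r * ((1 / r + Real.sqrt M + 4 * Real.sqrt θ₀ + Real.sqrt L) / Real.sqrt (Real.log 2) + 1)) / x ≤ d := by
  set A : ℝ := 1 / r + Real.sqrt M + 4 * Real.sqrt θ₀ + Real.sqrt L with hA
  have hA0 : 0 < A := by positivity
  have hl2 : 0 < Real.sqrt (Real.log 2) := Real.sqrt_pos.2 (Real.log_pos (by norm_num))
  have hx0 : 0 < x := lt_of_lt_of_le hl2 hx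
  -- `1/(2r) ≤ d (A + x)`
  have h1 : 1 / (2 * r) ≤ d * (A + x) := by
    have e1 : (1 - d) / r = 1 / r - d * (1 / r) := by field_simp
    have e2 : d * (A + x) = d * (1 / r) + d * Real.sqrt M + 4 * Real.sqrt θ₀ * d + (x + Real.sqrt L) * d := by
      rw [hA]; ring
    have e3 : 1 / (2 * r) = 1 / r - 1 / (2 * r) := by field_simp; ring
    rw [e2, e3]
    rw [e1] at hmain
    linarith
  -- `A + x ≤ x (A/√log 2 + 1)`
  have h2 : A + x ≤ x * (A / Real.sqrt (Real.log 2) + 1) := by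
    have : A ≤ x * (A / Real.sqrt (Real.log 2)) := by
      rw [mul_div_assoc', le_div_iff₀ hl2]
      nlinarith
    linarith
  have h3 : 1 / (2 * r) ≤ d * (x * (A / Real.sqrt (Real.log 2) + 1)) :=
    h1.trans (mul_le_mul_of_nonneg_left h2 hd)
  rw [div_le_iff₀ hx0, div_le_iff₀ (by positivity)]
  calc 1 = 2 * r * (1 / (2 * r)) := by field_simp
    _ ≤ 2 * r * (d * (x * (A / Real.sqrt (Real.log 2) + 1))) :=
        mul_le_mul_of_nonneg_left h3 (by positivity)
    _ = d * x * (2 * r * (A / Real.sqrt (Real.log 2) + 1)) := by ring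

/-- **The lower bound in real form.** There is an absolute `C > 0` such that for all real dilations
`1 ≤ a_k ≤ N`, real `c_k`, and `N ≥ 2`: `C/√log N ≤ ‖χ - Σ c_k ρ_{a_k}‖_{L²(0,∞)}`.
[cite: BaezDuarte2003, §1 (1.3)] [cite: BDBLS2000, main theorem] -/
theorem lowerBound_real : ∃ C : ℝ, 0 < C ∧ ∀ (n : ℕ) (a c : Fin n → ℝ) (N : ℝ),
    (∀ j, 1 ≤ a j ∧ a j ≤ N) → 2 ≤ N →
      C / Real.sqrt (Real.log N) ≤ Real.sqrt (∫ t in Ioi (0 : ℝ), ‖nbFun a c t‖ ^ 2) := by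
  obtain ⟨γ, hγ⟩ := exists_zeta_zero_half
  obtain ⟨K, hK, hLip⟩ := exists_lipschitz_uSymbol γ
  set r : ℝ := ‖(1 / 2 + γ * I : ℂ)‖ with hr
  have hrpos : 0 < r := by
    rw [hr, norm_pos_iff]
    intro h
    have := congrArg Complex.re h
    simp at this
  set M : ℝ := max (4 * K ^ 2) 77 with hM
  set θ₀ : ℝ := min (1 / 2) ((1 / (20 * r)) ^ 2) with hθ₀
  have hθ₀pos : 0 < θ₀ := by positivity
  have hθ₀le : θ₀ ≤ 1 / 2 := min_le_left _ _
  have hsqrtθ₀ : 10 * Real.sqrt θ₀ ≤ 1 / (2 * r) := by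
    have h1 : Real.sqrt θ₀ ≤ Real.sqrt ((1 / (20 * r)) ^ 2) := Real.sqrt_le_sqrt (min_le_right _ _)
    rw [Real.sqrt_sq (by positivity)] at h1
    calc 10 * Real.sqrt θ₀ ≤ 10 * (1 / (20 * r)) := by linarith
      _ = 1 / (2 * r) := by field_simp; ring
  set L : ℝ := Real.log (1 / θ₀) with hL

  refine ⟨1 / (2 * r * ((1 / r + Real.sqrt M + 4 * Real.sqrt θ₀ + Real.sqrt L) / Real.sqrt (Real.log 2) + 1)),
    by positivity, fun n a c N haN hN ↦ ?_⟩
  have hcore := core_ineq a c hγ hK hLip haN hN hθ₀pos hθ₀le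
  have hx : Real.sqrt (Real.log 2) ≤ Real.sqrt (Real.log N) :=
    Real.sqrt_le_sqrt (Real.log_le_log (by norm_num) hN)
  exact const_step hrpos (Real.sqrt_nonneg _) hx hsqrtθ₀ hcore

end BaezDuarteU

end Literature.NumberTheory.LFunctions
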